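import Mathlib.Analysis.Calculus.FDeriv.Comp
import Mathlib.Analysis.Calculus.FDeriv.Add
import Mathlib.Analysis.Calculus.FDeriv.Linear
import Mathlib.Analysis.Calculus.Deriv.Basic
import HarnessLib

/-!
# Crux `AnchorGap` (stmt-QuantumFields-11141), line `registered` — functions of a subset of the pair
# coordinates: their line derivatives off the subset vanish (step (G5c) of the assembly of GREP)

In GREP (`stub_gaussianBBFPolymerRep`) the peeled function `σ ↦ E(cov X σ)(ΠG)` reads the pair
parameters `σ ℓ` only for pairs `ℓ` of atoms of `X`; hence every term of ✓PEEL's expansion belonging to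
a script with a point outside `X` vanishes: the first line leaving `X` differentiates a function that
does not depend on that coordinate.  This file proves the generic calculus facts (def-free; the
dependence is spelled `∀ σ τ, (∀ ℓ ∈ P, σ ℓ = τ ℓ) → g σ = g τ`):

* `fderiv_single_eq_zero_of_dependsOn` — `ℓ ∉ P ⇒ fderiv g x e_ℓ = 0`;
* `dependsOn_fderiv_apply` — `x ↦ fderiv g x v` again depends only on the coordinates in `P`;
* `foldl_fderiv_const_zero`, `foldl_fderiv_eq_zero_of_exists_not_mem` — an iterated line derivative
  along a list containing a line off `P` is identically zero.
[folklore]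
-/

set_option autoImplicit false

namespace Summit.QuantumFields.YangMills.Theorems.AnchorGap.CoordDep

open Finset
open scoped Topology

variable {κ : Type}

/-- The coordinate projection onto `P` (zero elsewhere) as a continuous linear map. [folklore] -/
theorem exists_proj (P : Set κ) [DecidablePred (· ∈ P)] :
    ∃ π : (κ → ℝ) →L[ℝ] (κ → ℝ), ∀ σ ℓ, π σ ℓ = if ℓ ∈ P then σ ℓ else 0 := by
  refine ⟨ContinuousLinearMap.pi fun ℓ => if ℓ ∈ P then ContinuousLinearMap.proj ℓ else 0, fun σ ℓ => ?_⟩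
  simp only [ContinuousLinearMap.pi_apply]
  split_ifs <;> simp

/-- A function of the `P`-coordinates is its own composite with the affine map
`y ↦ x + π(y − τ)` through any two points `x, τ` with the same `P`-coordinates. [folklore] -/
theorem eq_comp_affine {P : Set κ} [DecidablePred (· ∈ P)] {g : (κ → ℝ) → ℝ}
    (hg : ∀ σ τ : κ → ℝ, (∀ ℓ ∈ P, σ ℓ = τ ℓ) → g σ = g τ)
    {π : (κ → ℝ) →L[ℝ] (κ → ℝ)} (hπ : ∀ σ ℓ, π σ ℓ = if ℓ ∈ P then σ ℓ else 0)
    {x τ : κ → ℝ} (hxτ : ∀ ℓ ∈ P, x ℓ = τ ℓ) :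
    g = fun y => g (x + π (y - τ)) := by
  funext y
  refine hg y _ fun ℓ hℓ => ?_
  simp only [Pi.add_apply, hπ, if_pos hℓ, Pi.sub_apply, hxτ ℓ hℓ]
  ring

/-- Differentiability transports between points with the same `P`-coordinates, with
`fderiv g τ = fderiv g x ∘ π`. [folklore] -/
theorem hasFDerivAt_of_dependsOn [Fintype κ] {P : Set κ} [DecidablePred (· ∈ P)] {g : (κ → ℝ) → ℝ}
    (hg : ∀ σ τ : κ → ℝ, (∀ ℓ ∈ P, σ ℓ = τ ℓ) → g σ = g τ)
    {π : (κ → ℝ) →L[ℝ] (κ → ℝ)} (hπ : ∀ σ ℓ, π σ ℓ = if ℓ ∈ P then σ ℓ else 0)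
    {x τ : κ → ℝ} (hxτ : ∀ ℓ ∈ P, x ℓ = τ ℓ) (hd : DifferentiableAt ℝ g x) :
    HasFDerivAt g ((fderiv ℝ g x).comp π) τ := by
  have hA : HasFDerivAt (fun y : κ → ℝ => x + π (y - τ)) π τ := by
    have h := ((π.hasFDerivAt (x := τ)).sub_const (π τ)).const_add x
    have heq : (fun y : κ → ℝ => x + (π y - π τ)) = fun y => x + π (y - τ) := by
      funext y; rw [map_sub]
    rw [heq] at h
    exact h
  have hpt : x + π (τ - τ) = x := by simp
  have hgx : HasFDerivAt g (fderiv ℝ g x) (x + π (τ - τ)) := by rw [hpt]; exact hd.hasFDerivAt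
  have h : HasFDerivAt (fun y => g (x + π (y - τ))) ((fderiv ℝ g x).comp π) τ := hgx.comp τ hA
  rw [← eq_comp_affine hg hπ hxτ] at h
  exact h

/-- **Line derivatives off the coordinate set vanish.** [folklore] -/
theorem fderiv_single_eq_zero_of_dependsOn [Fintype κ] [DecidableEq κ] {P : Set κ} {g : (κ → ℝ) → ℝ}
    (hg : ∀ σ τ : κ → ℝ, (∀ ℓ ∈ P, σ ℓ = τ ℓ) → g σ = g τ) {ℓ : κ} (hℓ : ℓ ∉ P) (x : κ → ℝ) :
    fderiv ℝ g x (Pi.single ℓ 1) = 0 := by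
  classical
  obtain ⟨π, hπ⟩ := exists_proj (κ := κ) P
  by_cases hd : DifferentiableAt ℝ g x
  · have h := hasFDerivAt_of_dependsOn hg hπ (x := x) (τ := x) (fun _ _ => rfl) hd
    rw [h.fderiv, ContinuousLinearMap.comp_apply]
    have hπe : π (Pi.single ℓ 1) = 0 := by
      funext ℓ'
      rw [hπ]
      by_cases h' : ℓ' ∈ P
      · rw [if_pos h', Pi.single_eq_of_ne (ne_of_mem_of_not_mem h' hℓ)]; rfl
      · rw [if_neg h']; rfl
    rw [hπe, map_zero]
  · rw [fderiv_zero_of_not_differentiableAt hd]; rfl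

/-- **Line derivatives of a function of the `P`-coordinates depend only on the `P`-coordinates.**
[folklore] -/
theorem dependsOn_fderiv_apply [Fintype κ] {P : Set κ} {g : (κ → ℝ) → ℝ}
    (hg : ∀ σ τ : κ → ℝ, (∀ ℓ ∈ P, σ ℓ = τ ℓ) → g σ = g τ) (v : κ → ℝ) :
    ∀ σ τ : κ → ℝ, (∀ ℓ ∈ P, σ ℓ = τ ℓ) → fderiv ℝ g σ v = fderiv ℝ g τ v := by
  classical
  obtain ⟨π, hπ⟩ := exists_proj (κ := κ) P
  -- at a differentiable point the derivative is `fderiv g x ∘ π`, at both points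
  have key : ∀ x τ : κ → ℝ, (∀ ℓ ∈ P, x ℓ = τ ℓ) → DifferentiableAt ℝ g x →
      fderiv ℝ g τ = (fderiv ℝ g x).comp π := fun x τ hxτ hd =>
    (hasFDerivAt_of_dependsOn hg hπ hxτ hd).fderiv
  intro σ τ hστ
  by_cases hσ : DifferentiableAt ℝ g σ
  · have h1 := key σ τ hστ hσ
    have h2 := key σ σ (fun _ _ => rfl) hσ
    calc fderiv ℝ g σ v = ((fderiv ℝ g σ).comp π) v := by rw [← h2]
      _ = fderiv ℝ g τ v := by rw [h1]
  · have hτ : ¬ DifferentiableAt ℝ g τ := fun hτ =>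
      hσ (hasFDerivAt_of_dependsOn hg hπ (fun ℓ hℓ => (hστ ℓ hℓ).symm) hτ).differentiableAt
    rw [fderiv_zero_of_not_differentiableAt hσ, fderiv_zero_of_not_differentiableAt hτ]

/-- Iterated line derivatives of the zero function vanish. [folklore] -/
theorem foldl_fderiv_const_zero [Fintype κ] [DecidableEq κ] (L : List κ) :
    L.foldl (fun (g : (κ → ℝ) → ℝ) (ℓ : κ) => fun x : κ → ℝ => fderiv ℝ g x (Pi.single ℓ 1))
      (fun _ => (0 : ℝ)) = fun _ => 0 := by
  induction L with
  | nil => rfl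
  | cons ℓ L ih =>
    simp only [List.foldl_cons]
    have h : (fun x : κ → ℝ => fderiv ℝ (fun _ : κ → ℝ => (0 : ℝ)) x (Pi.single ℓ 1)) = fun _ => 0 := by
      funext x; simp
    rw [h, ih]

/-- **An iterated line derivative along a list with a line off `P` is identically zero** for a
function of the `P`-coordinates. [folklore] -/
theorem foldl_fderiv_eq_zero_of_exists_not_mem [Fintype κ] [DecidableEq κ] {P : Set κ} :
    ∀ (L : List κ) (g : (κ → ℝ) → ℝ), (∀ σ τ : κ → ℝ, (∀ ℓ ∈ P, σ ℓ = τ ℓ) → g σ = g τ) →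
      (∃ ℓ ∈ L, ℓ ∉ P) →
      L.foldl (fun (g : (κ → ℝ) → ℝ) (ℓ : κ) => fun x : κ → ℝ => fderiv ℝ g x (Pi.single ℓ 1)) g
        = fun _ => 0 := by
  intro L
  induction L with
  | nil => intro g _ h; obtain ⟨ℓ, hℓ, -⟩ := h; exact absurd hℓ List.not_mem_nil
  | cons ℓ L ih =>
    intro g hg hex
    simp only [List.foldl_cons]
    by_cases hℓ : ℓ ∈ P
    · refine ih _ (dependsOn_fderiv_apply hg _) ?_
      obtain ⟨ℓ', hℓ', hℓ'P⟩ := hex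
      rcases List.mem_cons.1 hℓ' with rfl | h
      · exact absurd hℓ hℓ'P
      · exact ⟨ℓ', h, hℓ'P⟩
    · have h0 : (fun x : κ → ℝ => fderiv ℝ g x (Pi.single ℓ 1)) = fun _ => 0 := by
        funext x; exact fderiv_single_eq_zero_of_dependsOn hg hℓ x
      rw [h0, foldl_fderiv_const_zero]

end Summit.QuantumFields.YangMills.Theorems.AnchorGap.CoordDep
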